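import Summits.CriticalPhenomena.PercolationContinuityZ3.Theorems.SahiMasterFamilySupport

/-!
# Redundancy in the definition of `Z_3`: the pair clause follows from the two modified clauses

Unit `prim-master-conj` (crux anchor stmt-CriticalPhenomena-4575), gen 8 (paper: BOTTOM-COEFFICIENT.md §7.3).  The zero-flag class
`Z_3 = SuppZeroFlag 3` peels a slot `G` of `(X, Y, G)` and asks for THREE independences: `(X, Y)`, `(X ∩ G, Y)` and `(X, Y ∩ G)` in `Z_2`
(`ZVia X Y G`).  For non-empty increasing events the first is implied by the other two:

* `disjoint_esupp_of_inter` (**Redundancy lemma**): if `esupp (X ∩ G)` is disjoint from `esupp Y` and `esupp X` from `esupp (Y ∩ G)`,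
  then `esupp X` is disjoint from `esupp Y`.  Proof: a coordinate `e` affecting both `X` and `Y` cannot affect `X ∩ G`; take a
  MAXIMAL `e`-free configuration `ω` outside `X` with `insert e ω ∈ X`; then `insert e ω ∉ G`, every coordinate `f` outside `insert e ω`
  satisfies `insert f ω ∈ X` (maximality) and so affects `X`, hence does not affect `Y ∩ G`; stripping these coordinates from `univ ∈ Y ∩ G`
  one at a time lands on `insert e ω ∈ Y ∩ G ⊆ G` — contradiction.
* `zVia_of_inter`, `suppZeroFlag_three_of_inter`: hence `(X ∩ G, Y) ∈ Z_2` and `(X, Y ∩ G) ∈ Z_2` already give `(X, Y, G) ∈ Z_3`.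
This is the order-3 case of the REDUNDANCY conjecture of the bottom-coefficient programme (if every modified family
`U_{−i}[l ↦ U_l ∩ U_i]` is a zero flag then so is `U_{−i}`, every order), which together with the bottom-coefficient recursion reduces
(EQI-k) to (EQI-(k−1)) on families with a uniform peeling slot.  Everything here is proved; axioms standard. [this work]
-/

noncomputable section

open scoped Classical

namespace Summit.CriticalPhenomena.PercolationContinuityZ3.Theorems

open Finset Function
open Literature.Probability.LatticeModels.Kahn2022 (Affects)

variable {ι : Type} [Fintype ι]

omit [Fintype ι] in
/-- Stripping non-affecting coordinates: if no `f ∈ T` affects the increasing event `A` and `univ ∈ A`, then `univ \ T ∈ A`.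
[folklore] -/
theorem univ_diff_mem_of_forall_not_affects {A : Set (Set ι)} (hA : IsUpperSet A) (huniv : Set.univ ∈ A)
    (T : Finset ι) (hT : ∀ f ∈ T, ¬ Affects A f) : Set.univ \ (↑T : Set ι) ∈ A := by
  induction T using Finset.induction_on with
  | empty => simpa using huniv
  | insert f T hfT ih =>
    have hT' : ∀ g ∈ T, ¬ Affects A g := fun g hg => hT g (mem_insert_of_mem hg)
    have hmem := ih hT'
    have hf : ¬ Affects A f := hT f (mem_insert_self f T)
    -- `univ \ T = insert f (univ \ insert f T)`
    have heq : insert f (Set.univ \ (↑(insert f T) : Set ι)) = Set.univ \ (↑T : Set ι) := by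
      ext i
      simp only [Set.mem_insert_iff, Set.mem_sdiff, Set.mem_univ, true_and, coe_insert, not_or]
      constructor
      · rintro (rfl | ⟨-, hi⟩)
        · exact_mod_cast hfT
        · exact hi
      · intro hi
        by_cases hif : i = f
        · exact Or.inl hif
        · exact Or.inr ⟨hif, hi⟩
    rw [← heq, insert_mem_iff_of_not_affects hA hf] at hmem
    exact hmem

/-- **Redundancy lemma.**  For non-empty increasing events `X, Y, G`: if `esupp (X ∩ G) ∩ esupp Y = ∅` and `esupp X ∩ esupp (Y ∩ G) = ∅`
then `esupp X ∩ esupp Y = ∅`. [this work] -/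
theorem disjoint_esupp_of_inter {X Y G : Set (Set ι)} (hX : IsUpperSet X) (hY : IsUpperSet Y) (hG : IsUpperSet G)
    (hYne : Y.Nonempty) (hGne : G.Nonempty)
    (h1 : Disjoint (esupp (X ∩ G)) (esupp Y)) (h2 : Disjoint (esupp X) (esupp (Y ∩ G))) :
    Disjoint (esupp X) (esupp Y) := by
  rw [Finset.disjoint_left]
  intro e heX heY
  have hXG : ¬ Affects (X ∩ G) e := fun h => Finset.disjoint_left.1 h1 (mem_esupp.2 h) heY
  -- the set of `e`-free configurations at which `e` is pivotal for `X`
  set P : Set (Set ι) := {ω | e ∉ ω ∧ ω ∉ X ∧ insert e ω ∈ X} with hP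
  have hPne : P.Nonempty := by
    obtain ⟨ω, hω, heω⟩ := mem_esupp.1 heX
    refine ⟨ω, fun he => hω ?_, hω, heω⟩
    rwa [Set.insert_eq_of_mem he] at heω
  obtain ⟨ω, hmax⟩ := Set.Finite.exists_maximal (Set.toFinite P) hPne
  obtain ⟨heω, hωX, heωX⟩ : ω ∈ P := hmax.prop
  -- `insert e ω ∉ G`: otherwise `e` would affect `X ∩ G` at `ω`
  have hωG : insert e ω ∉ G := fun hG' => hXG ⟨ω, fun h => hωX h.1, heωX, hG'⟩
  -- maximality: every coordinate outside `insert e ω` completes `ω` into `X`, hence affects `X`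
  set T : Finset ι := univ.filter fun f => f ∉ insert e ω with hT
  have hTaff : ∀ f ∈ T, Affects X f := by
    intro f hf
    have hf' : f ∉ insert e ω := (mem_filter.1 hf).2
    have hfe : f ≠ e := fun h => hf' (h ▸ Set.mem_insert e ω)
    have hfω : f ∉ ω := fun h => hf' (Set.mem_insert_of_mem e h)
    refine ⟨ω, hωX, ?_⟩
    by_contra hfX
    have hPins : insert f ω ∈ P := by
      refine ⟨?_, hfX, ?_⟩
      · simp only [Set.mem_insert_iff, not_or]; exact ⟨hfe.symm, heω⟩
      · rw [Set.insert_comm]; exact hX (Set.subset_insert f _) heωX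
    exact hfω (hmax.mem_of_prop_insert hPins)
  -- so no `f ∈ T` affects `Y ∩ G`
  have hTnot : ∀ f ∈ T, ¬ Affects (Y ∩ G) f := fun f hf hYG =>
    Finset.disjoint_left.1 h2 (mem_esupp.2 (hTaff f hf)) (mem_esupp.2 hYG)
  -- strip `T` from `univ ∈ Y ∩ G`: `univ \ T = insert e ω ∈ Y ∩ G ⊆ G`, contradiction
  have huniv : Set.univ ∈ Y ∩ G := ⟨univ_mem_of_nonempty hY hYne, univ_mem_of_nonempty hG hGne⟩
  have hstrip := univ_diff_mem_of_forall_not_affects (hY.inter hG) huniv T hTnot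
  have heq : Set.univ \ (↑T : Set ι) = insert e ω := by
    ext i
    simp only [Set.mem_sdiff, Set.mem_univ, true_and, hT, coe_filter, mem_univ, Set.mem_setOf_eq, not_not]
  rw [heq] at hstrip
  exact hωG hstrip.2

/-- **`Z_3` from the two modified clauses**: `(X ∩ G, Y) ∈ Z_2` and `(X, Y ∩ G) ∈ Z_2` give `(X, Y, G) ∈ Z_3` via `(X, Y)` (non-empty
increasing events). [this work] -/
theorem zVia_of_inter {X Y G : Set (Set ι)} (hX : IsUpperSet X) (hY : IsUpperSet Y) (hG : IsUpperSet G)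
    (hYne : Y.Nonempty) (hGne : G.Nonempty)
    (h1 : SuppZeroFlag 2 ![X ∩ G, Y]) (h2 : SuppZeroFlag 2 ![X, Y ∩ G]) : ZVia X Y G :=
  ⟨(suppZeroFlag_two_iff hX hY).2 (disjoint_esupp_of_inter hX hY hG hYne hGne
    ((suppZeroFlag_two_iff (hX.inter hG) hY).1 h1) ((suppZeroFlag_two_iff hX (hY.inter hG)).1 h2)), h1, h2⟩

/-- **Redundancy at order 3**: `(X ∩ G, Y) ∈ Z_2` and `(X, Y ∩ G) ∈ Z_2` already give `(X, Y, G) ∈ Z_3`. [this work] -/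
theorem suppZeroFlag_three_of_inter {X Y G : Set (Set ι)} (hX : IsUpperSet X) (hY : IsUpperSet Y) (hG : IsUpperSet G)
    (hYne : Y.Nonempty) (hGne : G.Nonempty)
    (h1 : SuppZeroFlag 2 ![X ∩ G, Y]) (h2 : SuppZeroFlag 2 ![X, Y ∩ G]) : SuppZeroFlag 3 ![X, Y, G] :=
  (suppZeroFlag_three_iff_zVia X Y G).2 (Or.inr (Or.inr (zVia_of_inter hX hY hG hYne hGne h1 h2)))

end Summit.CriticalPhenomena.PercolationContinuityZ3.Theorems
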